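import Summits.BirchSwinnertonDyer.Rank1Residual.AdditivePotMult.QuadraticBaseChangeTamagawaTypeIVInertLocal
import Summits.BirchSwinnertonDyer.Rank1Residual.AdditivePotMult.QuadraticBaseChangeTamagawaTypeIVUnramified
import Summits.BirchSwinnertonDyer.Rank1Residual.AdditivePotMult.QuadraticBaseChangeOddTamagawaPlaces
import Literature.NumberTheory.Automorphic.AdeleBaseChange
import Literature.NumberTheory.EllipticCurves.HasseWeilAbelianLSeriesProofs
import HarnessLib

/-!
# (T) at an INERT place of Kodaira type `IV` / `IV*`: `v₃(c_w(W_K)) = v₃(c_v(W)) + v₃(c_v(W^{(d_K)})) = 1`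

Row **T-MIL-B, stage B-3** (n1011-p08 GEN 3) of the T-MIL-ODD line (n1011-p01): the `p = 3` entry
of Milne's per-place identity (T) `Σ_{w ∣ v} v_p(c_w(W_K)) = v_p(c_v(W)) + v_p(c_v(W_d))` at an
additive place `v` of `W/ℚ` of Kodaira type `IV` or `IV*` which is INERT in the quadratic field `K`
(one place `w`, `e(w|v) = 1`, `f(w|v) = 2`), residue characteristic `ℓ ≠ 2, 3`, in the fibre-sum
currency of n1011-p01's `QuadraticBaseChangeOddTamagawaPlaces` (C-3b).

* `K`-side (§4): `c_w(W_K) = 3`. The local base-change map `ι : ℚ_v → K_w`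
  (`Literature.NumberTheory.Automorphic.adicCompletionOfLiesOver`) restricts to a LOCAL homomorphism
  `𝒪_v → 𝒪_w` which, `e` being `1`, sends the uniformiser to a uniformiser (sibling file `…TypeIVInertLocal` §1: an element
  of `𝒪_w` is irreducible iff its valuation is `exp (-1)`); the residue extension has degree `f = 2` (§4,
  by counting: `#κ(𝒪_w) = N(w) = ℓ^f`, `#κ(𝒪_v) = ℓ`); the minimal type-`IV` normal form `J` of `W`
  at `v` (B-2e `exists_normalForm_IV_of_kodairaSymbolAt_eq_IV`) stays a MINIMAL normal form over
  `𝒪_w` because `Δ(J) = ϖ⁴ · unit` (resp. `ϖ⁸ · unit` at `IV*`) when `ℓ ≠ 3` (sibling §2–§3) and an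
  integral equation with `v(Δ) < 12` is minimal (sibling §1); then B-2c
  `localTamagawaNumber_baseChange_eq_three_of_even_finrank_of_normalForm_IV` (a quadratic over
  `𝔽_ℓ` splits in `𝔽_{ℓ²}`) gives `c_w = 3`.
* `ℚ`-side: B-2e `padicValNat_localTamagawaNumber_add_quadraticTwist_eq_one_of_kodairaSymbolAt_eq_IV`
  (`d_K` is a non-square unit at an inert odd `ℓ`, n1011-p01 `not_dvd_and_not_isSquare_discr_of_inert`).
* §5 assembles the fibre sum: `Σ_{w ∣ v} v₃(c_w(W_K)) = 1 = v₃(c_v(W)) + v₃(c_v(W_d))`.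

OUT (said loudly): `ℓ = 2`; `ℓ = 3` (that place is the (P)-term of the formula, not a (T)-term);
ramified `v` (the twist side is of type `II`/`II*`, binder of the row); `p ≠ 3` (the `p`-parts for
`p ≥ 5` vanish identically at additive places and belong to n1011-p01's A-files).
HONEST FRAMING: TOOL theorems; nothing booked; no mark moved; no new definition, no named fact.

References: Silverman *ATAEC* IV.9.4 (Tate's algorithm, Steps 5 and 8); Silverman *AEC* VII.1
Remark 1.1 (the `v(Δ) < 12` criterion), VII.5.4 (a) / VII.6; Milne 1972 §1 and Kramer 1981 §2 for the
shape of (T); Dokchitser–Dokchitser 2010 p. 580 Case 4c (corroboration of `C_v(M) = 3` at inert `M/K`).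
-/

noncomputable section

open scoped Classical NumberField
open WeierstrassCurve NumberField IsDedekindDomain IsLocalRing Polynomial Rat.HeightOneSpectrum
  Literature.NumberTheory.DiophantineGeometry.TateAlgorithm
  Literature.NumberTheory.EllipticCurves Literature.NumberTheory.EllipticCurves.LocalIndex
  Summit.BirchSwinnertonDyer.Rank1Residual.Additive

namespace Summit.BirchSwinnertonDyer.Rank1Residual.AdditivePotMult

namespace TypeIVTwist

/-! ## §4 The `K`-side at an UNRAMIFIED place of EVEN residue degree: `c_w(W_K) = 3` -/

section KSide

variable {K : Type} [Field K] [NumberField K] (v : HeightOneSpectrum (𝓞 ℚ))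
  (W : WeierstrassCurve ℚ) [W.IsElliptic]

/-- `3` is a unit of `𝒪_v` at a place `v ∤ 3` of `ℚ`. [folklore] -/
theorem isUnit_three_adicCompletionIntegers (hv3 : (primesEquiv v : ℕ) ≠ 3) :
    IsUnit (3 : v.adicCompletionIntegers ℚ) := by
  have h3 : ¬ ((primesEquiv v : ℕ) : ℤ) ∣ (3 : ℤ) := by
    intro h
    have h' : (primesEquiv v : ℕ) ∣ 3 := by exact_mod_cast h
    exact hv3 ((Nat.prime_dvd_prime_iff_eq (primesEquiv v).2 Nat.prime_three).mp h')
  simpa using isUnit_adicCompletionIntegers_intCast v h3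

/-- **The residue extension `κ(𝒪_v) → κ(𝒪_w)` of the local base-change map has degree `f(w|v)`**
(for ANY local homomorphism `𝒪_v → 𝒪_w` making `κ(𝒪_w)` a `κ(𝒪_v)`-algebra): a count,
`#κ(𝒪_w) = N(w) = ℓ^f` (n1011-p01 `absNorm_eq_pow_of_under_eq`) and `#κ(𝒪_v) = ℓ`. [folklore] -/
theorem finrank_residueField_eq_inertiaDeg {w : HeightOneSpectrum (𝓞 K)} (hw : w.under (𝓞 ℚ) = v)
    [Algebra (ResidueField (v.adicCompletionIntegers ℚ)) (ResidueField (w.adicCompletionIntegers K))] :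
    Module.finrank (ResidueField (v.adicCompletionIntegers ℚ)) (ResidueField (w.adicCompletionIntegers K)) =
      w.asIdeal.inertiaDeg (𝓞 ℚ) := by
  haveI : Finite (ResidueField (w.adicCompletionIntegers K)) := inferInstance
  haveI : Module.Finite (ResidueField (v.adicCompletionIntegers ℚ))
      (ResidueField (w.adicCompletionIntegers K)) := Module.Finite.of_finite
  have hpow := Module.natCard_eq_pow_finrank (K := ResidueField (v.adicCompletionIntegers ℚ))
    (V := ResidueField (w.adicCompletionIntegers K))
  rw [HeightOneSpectrum.natCard_residueField_adicCompletionIntegers_eq_absNorm,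
    absNorm_eq_pow_of_under_eq hw, WeierstrassCurve.natCard_residueField_adicCompletionIntegers v] at hpow
  exact (Nat.pow_right_injective (primesEquiv v).2.two_le hpow).symm

/-- **`c_w(W_K) = 3` at an unramified place `w ∣ v` of even residue degree over a place `v ∤ 3`
of `ℚ` of Kodaira type `IV`** (so at every INERT such place of a quadratic field). The local
base-change map `ι : ℚ_v → K_w` restricts to a local homomorphism `𝒪_v → 𝒪_w` carrying the
uniformiser to a uniformiser (`e = 1`, §1); the minimal type-`IV` normal form of `W` at `v` (B-2e)
stays integral and minimal over `𝒪_w` (`v_w(Δ) = exp (-4)`, §3, Silverman *AEC* VII.1 Remark 1.1),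
and the Step-5 quadratic, irreducible or not over `𝔽_ℓ`, has a root in the even-degree extension
`κ(𝒪_w)` (B-2c `localTamagawaNumber_baseChange_eq_three_of_even_finrank_of_normalForm_IV`).
Dokchitser–Dokchitser 2010 p. 580 Case 4c records the same value (corroboration only).
[cite: SilvermanATAEC1994, IV.9.4 Step 5 (PDF p. 344)] [cite: SilvermanAEC2009, Prop. VII.5.4 (a)] -/
theorem localTamagawaNumber_baseChange_eq_three_of_kodairaSymbolAt_eq_IV_of_unramified_of_even
    (hv3 : (primesEquiv v : ℕ) ≠ 3) (hIV : W.kodairaSymbolAt v = .IV) {w : HeightOneSpectrum (𝓞 K)}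
    (hw : w.under (𝓞 ℚ) = v) (he : w.asIdeal.ramificationIdx (𝓞 ℚ) = 1)
    (hf : Even (w.asIdeal.inertiaDeg (𝓞 ℚ))) :
    ((W.baseChange K).baseChange (w.adicCompletion K)).localTamagawaNumber
        (w.adicCompletionIntegers K) = 3 := by
  haveI hlies : w.asIdeal.LiesOver v.asIdeal := ⟨by rw [← hw]; rfl⟩
  haveI : Finite (ResidueField (v.adicCompletionIntegers ℚ)) :=
    finite_residueField_adicCompletionIntegers_rat v
  haveI : PerfectField (ResidueField (v.adicCompletionIntegers ℚ)) := PerfectField.ofFinite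
  haveI : (W.baseChange (v.adicCompletion ℚ)).IsElliptic := by rw [baseChange]; infer_instance
  -- the local base-change map and its restriction to the valuation rings
  set ι : v.adicCompletion ℚ →+* w.adicCompletion K :=
    Literature.NumberTheory.Automorphic.adicCompletionOfLiesOver ℚ K v w with hιdef
  have hιv : ∀ y, Valued.v (ι y) = Valued.v y := fun y ↦ by
    rw [hιdef, Literature.NumberTheory.Automorphic.valued_adicCompletionOfLiesOver,
      ramificationIdx'_eq_of_under_eq hw, he, pow_one]
  have hint : ∀ y ∈ v.adicCompletionIntegers ℚ, ι y ∈ w.adicCompletionIntegers K := fun y hy ↦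
    Literature.NumberTheory.Automorphic.adicCompletionOfLiesOver_mem_adicCompletionIntegers ℚ K v w hy
  set ψ : v.adicCompletionIntegers ℚ →+* w.adicCompletionIntegers K :=
    ι.restrict (v.adicCompletionIntegers ℚ) (w.adicCompletionIntegers K) hint with hψdef
  have hψ : ∀ y : v.adicCompletionIntegers ℚ,
      ((ψ y : w.adicCompletionIntegers K) : w.adicCompletion K) = ι (y : v.adicCompletion ℚ) :=
    fun _ ↦ rfl
  letI algR : Algebra (v.adicCompletionIntegers ℚ) (w.adicCompletionIntegers K) := ψ.toAlgebra
  letI algF : Algebra (v.adicCompletion ℚ) (w.adicCompletion K) := ι.toAlgebra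
  letI algRL : Algebra (v.adicCompletionIntegers ℚ) (w.adicCompletion K) :=
    ((algebraMap (w.adicCompletionIntegers K) (w.adicCompletion K)).comp ψ).toAlgebra
  haveI : IsScalarTower (v.adicCompletionIntegers ℚ) (w.adicCompletionIntegers K)
      (w.adicCompletion K) := IsScalarTower.of_algebraMap_eq (fun _ ↦ rfl)
  haveI : IsScalarTower (v.adicCompletionIntegers ℚ) (v.adicCompletion ℚ) (w.adicCompletion K) :=
    IsScalarTower.of_algebraMap_eq (fun _ ↦ rfl)
  have halg : ∀ y : v.adicCompletionIntegers ℚ,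
      algebraMap (v.adicCompletionIntegers ℚ) (w.adicCompletionIntegers K) y = ψ y := fun _ ↦ rfl
  haveI : IsLocalHom (algebraMap (v.adicCompletionIntegers ℚ) (w.adicCompletionIntegers K)) := by
    refine ⟨fun y hy ↦ ?_⟩
    rw [HeightOneSpectrum.adicCompletionIntegers.isUnit_iff_valued_eq_one] at hy ⊢
    rwa [halg, hψ, hιv] at hy
  -- the minimal type-`IV` normal form at `v`
  obtain ⟨J, D, γ, ε, hJ, -, h1, h2, hγ, h4, hε, hdisc⟩ :=
    exists_normalForm_IV_of_kodairaSymbolAt_eq_IV v W hIV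
  have hϖ : Irreducible (algebraMap (v.adicCompletionIntegers ℚ) (w.adicCompletionIntegers K)
      (uniformizer (v.adicCompletionIntegers ℚ))) := by
    rw [irreducible_iff_valued_eq_exp_neg_one, halg, hψ, hιv]
    exact valued_eq_exp_neg_one_of_irreducible v irreducible_uniformizer
  have h3 := isUnit_three_adicCompletionIntegers v hv3
  -- minimality upstairs: `v_w(Δ) = exp (-4) > exp (-12)`
  haveI : ((J.map (algebraMap (v.adicCompletionIntegers ℚ) (w.adicCompletionIntegers K))).baseChange
      (w.adicCompletion K)).IsMinimal (w.adicCompletionIntegers K) := by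
    haveI : ((J.map (algebraMap (v.adicCompletionIntegers ℚ) (w.adicCompletionIntegers K))).baseChange
        (w.adicCompletion K)).IsIntegral (w.adicCompletionIntegers K) := ⟨⟨_, rfl⟩⟩
    apply isMinimal_of_exp_neg_twelve_lt_valued_Δ_place
    have hΔ : ((J.map (algebraMap (v.adicCompletionIntegers ℚ) (w.adicCompletionIntegers K))).baseChange
        (w.adicCompletion K)).Δ = ι ((J.Δ : v.adicCompletionIntegers ℚ) : v.adicCompletion ℚ) := by
      rw [baseChange, map_Δ, map_Δ, halg, ← hψ]; rfl
    rw [hΔ, hιv]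
    exact exp_neg_twelve_lt_valued_Δ_of_normalForm_IV v J h1 h2 irreducible_uniformizer hγ h4 hε
      hdisc h3
  -- `W_K ⊗ K_w = (W ⊗ ℚ_v) ⊗_ι K_w` (ring maps out of `ℚ` agree)
  have hcurve : (W.baseChange K).baseChange (w.adicCompletion K) =
      (W.baseChange (v.adicCompletion ℚ)).baseChange (w.adicCompletion K) := by
    simp only [baseChange, WeierstrassCurve.map_map]
    rw [Subsingleton.elim ((algebraMap K (w.adicCompletion K)).comp (algebraMap ℚ K))
      ((algebraMap (v.adicCompletion ℚ) (w.adicCompletion K)).comp (algebraMap ℚ (v.adicCompletion ℚ)))]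
  rw [hcurve]
  have heven : Even (Module.finrank (ResidueField (v.adicCompletionIntegers ℚ))
      (ResidueField (w.adicCompletionIntegers K))) := by
    rw [finrank_residueField_eq_inertiaDeg v hw]; exact hf
  exact localTamagawaNumber_baseChange_eq_three_of_even_finrank_of_normalForm_IV
    (W.baseChange (v.adicCompletion ℚ)) J D hJ h1 h2 hϖ hγ h4 hε hdisc heven

/-- **`c_w(W_K) = 3` at an unramified place `w ∣ v` of even residue degree over a place `v ∤ 3` of
`ℚ` of Kodaira type `IV*`** — the Step-8 twin of the previous theorem (`v_w(Δ) = exp (-8)`; B-2c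
`localTamagawaNumber_baseChange_eq_three_iff_of_normalForm_IVstar` and n1011-p01
`splits_map_of_natDegree_eq_two_of_even_finrank`).
[cite: SilvermanATAEC1994, IV.9.4 Step 8 (PDF p. 346)] [cite: SilvermanAEC2009, Prop. VII.5.4 (a)] -/
theorem localTamagawaNumber_baseChange_eq_three_of_kodairaSymbolAt_eq_IVstar_of_unramified_of_even
    (hv3 : (primesEquiv v : ℕ) ≠ 3) (hIV : W.kodairaSymbolAt v = .IVstar) {w : HeightOneSpectrum (𝓞 K)}
    (hw : w.under (𝓞 ℚ) = v) (he : w.asIdeal.ramificationIdx (𝓞 ℚ) = 1)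
    (hf : Even (w.asIdeal.inertiaDeg (𝓞 ℚ))) :
    ((W.baseChange K).baseChange (w.adicCompletion K)).localTamagawaNumber
        (w.adicCompletionIntegers K) = 3 := by
  haveI hlies : w.asIdeal.LiesOver v.asIdeal := ⟨by rw [← hw]; rfl⟩
  haveI : Finite (ResidueField (v.adicCompletionIntegers ℚ)) :=
    finite_residueField_adicCompletionIntegers_rat v
  haveI : PerfectField (ResidueField (v.adicCompletionIntegers ℚ)) := PerfectField.ofFinite
  haveI : (W.baseChange (v.adicCompletion ℚ)).IsElliptic := by rw [baseChange]; infer_instance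
  set ι : v.adicCompletion ℚ →+* w.adicCompletion K :=
    Literature.NumberTheory.Automorphic.adicCompletionOfLiesOver ℚ K v w with hιdef
  have hιv : ∀ y, Valued.v (ι y) = Valued.v y := fun y ↦ by
    rw [hιdef, Literature.NumberTheory.Automorphic.valued_adicCompletionOfLiesOver,
      ramificationIdx'_eq_of_under_eq hw, he, pow_one]
  have hint : ∀ y ∈ v.adicCompletionIntegers ℚ, ι y ∈ w.adicCompletionIntegers K := fun y hy ↦
    Literature.NumberTheory.Automorphic.adicCompletionOfLiesOver_mem_adicCompletionIntegers ℚ K v w hy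
  set ψ : v.adicCompletionIntegers ℚ →+* w.adicCompletionIntegers K :=
    ι.restrict (v.adicCompletionIntegers ℚ) (w.adicCompletionIntegers K) hint with hψdef
  have hψ : ∀ y : v.adicCompletionIntegers ℚ,
      ((ψ y : w.adicCompletionIntegers K) : w.adicCompletion K) = ι (y : v.adicCompletion ℚ) :=
    fun _ ↦ rfl
  letI algR : Algebra (v.adicCompletionIntegers ℚ) (w.adicCompletionIntegers K) := ψ.toAlgebra
  letI algF : Algebra (v.adicCompletion ℚ) (w.adicCompletion K) := ι.toAlgebra
  letI algRL : Algebra (v.adicCompletionIntegers ℚ) (w.adicCompletion K) :=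
    ((algebraMap (w.adicCompletionIntegers K) (w.adicCompletion K)).comp ψ).toAlgebra
  haveI : IsScalarTower (v.adicCompletionIntegers ℚ) (w.adicCompletionIntegers K)
      (w.adicCompletion K) := IsScalarTower.of_algebraMap_eq (fun _ ↦ rfl)
  haveI : IsScalarTower (v.adicCompletionIntegers ℚ) (v.adicCompletion ℚ) (w.adicCompletion K) :=
    IsScalarTower.of_algebraMap_eq (fun _ ↦ rfl)
  have halg : ∀ y : v.adicCompletionIntegers ℚ,
      algebraMap (v.adicCompletionIntegers ℚ) (w.adicCompletionIntegers K) y = ψ y := fun _ ↦ rfl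
  haveI : IsLocalHom (algebraMap (v.adicCompletionIntegers ℚ) (w.adicCompletionIntegers K)) := by
    refine ⟨fun y hy ↦ ?_⟩
    rw [HeightOneSpectrum.adicCompletionIntegers.isUnit_iff_valued_eq_one] at hy ⊢
    rwa [halg, hψ, hιv] at hy
  obtain ⟨J, D, γ, ε, hJ, -, h1, h2, hγ, h4, hε, hdisc⟩ :=
    exists_normalForm_IVstar_of_kodairaSymbolAt_eq_IVstar v W hIV
  have hϖ : Irreducible (algebraMap (v.adicCompletionIntegers ℚ) (w.adicCompletionIntegers K)
      (uniformizer (v.adicCompletionIntegers ℚ))) := by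
    rw [irreducible_iff_valued_eq_exp_neg_one, halg, hψ, hιv]
    exact valued_eq_exp_neg_one_of_irreducible v irreducible_uniformizer
  have h3 := isUnit_three_adicCompletionIntegers v hv3
  haveI : ((J.map (algebraMap (v.adicCompletionIntegers ℚ) (w.adicCompletionIntegers K))).baseChange
      (w.adicCompletion K)).IsMinimal (w.adicCompletionIntegers K) := by
    haveI : ((J.map (algebraMap (v.adicCompletionIntegers ℚ) (w.adicCompletionIntegers K))).baseChange
        (w.adicCompletion K)).IsIntegral (w.adicCompletionIntegers K) := ⟨⟨_, rfl⟩⟩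
    apply isMinimal_of_exp_neg_twelve_lt_valued_Δ_place
    have hΔ : ((J.map (algebraMap (v.adicCompletionIntegers ℚ) (w.adicCompletionIntegers K))).baseChange
        (w.adicCompletion K)).Δ = ι ((J.Δ : v.adicCompletionIntegers ℚ) : v.adicCompletion ℚ) := by
      rw [baseChange, map_Δ, map_Δ, halg, ← hψ]; rfl
    rw [hΔ, hιv]
    exact exp_neg_twelve_lt_valued_Δ_of_normalForm_IVstar v J h1 h2 irreducible_uniformizer hγ h4 hε
      hdisc h3
  have hcurve : (W.baseChange K).baseChange (w.adicCompletion K) =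
      (W.baseChange (v.adicCompletion ℚ)).baseChange (w.adicCompletion K) := by
    simp only [baseChange, WeierstrassCurve.map_map]
    rw [Subsingleton.elim ((algebraMap K (w.adicCompletion K)).comp (algebraMap ℚ K))
      ((algebraMap (v.adicCompletion ℚ) (w.adicCompletion K)).comp (algebraMap ℚ (v.adicCompletion ℚ)))]
  rw [hcurve, localTamagawaNumber_baseChange_eq_three_iff_of_normalForm_IVstar
    (W.baseChange (v.adicCompletion ℚ)) J D hJ h1 h2 hϖ hγ h4 hε hdisc]
  have heven : Even (Module.finrank (ResidueField (v.adicCompletionIntegers ℚ))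
      (ResidueField (w.adicCompletionIntegers K))) := by
    rw [finrank_residueField_eq_inertiaDeg v hw]; exact hf
  have hspl := splits_map_of_natDegree_eq_two_of_even_finrank
    (E := ResidueField (w.adicCompletionIntegers K))
    (natDegree_stepQuadratic (residue _ γ) (residue _ ε)) heven
  have key := (exists_root_map_iff_splits (algebraMap (ResidueField (v.adicCompletionIntegers ℚ))
    (ResidueField (w.adicCompletionIntegers K))) (residue _ γ) (residue _ ε)).mpr hspl
  simpa only [ResidueField.algebraMap_residue] using key

end KSide

end TypeIVTwist

/-! ## §5 (T) at an INERT place of type `IV` / `IV*` in the fibre-sum currency of C-3b (`p = 3`) -/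

section Fibre

open TypeIVTwist

variable (W : WeierstrassCurve ℚ) [W.IsElliptic] {K : Type} [Field K] [NumberField K]
  (Wd : WeierstrassCurve ℚ) (v : HeightOneSpectrum (𝓞 ℚ))

/-- **(T) at an INERT place of Kodaira type `IV`, `p = 3`, `ℓ ≠ 2, 3`.** `W/ℚ` elliptic,
`[K:ℚ] = 2` with a single place `w` above `v`, `e = 1`, `f = 2`, `W_d = C_d • W^{(d_K)}`:
`Σ_{w ∣ v} v₃(c_w(W_K)) = v₃(3) = 1 = v₃(c_v(W)) + v₃(c_v(W_d))` — the `K`-side by §4, the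
`ℚ`-side by B-2e `padicValNat_localTamagawaNumber_add_quadraticTwist_eq_one_of_kodairaSymbolAt_eq_IV`
(`d_K` is a non-square unit at `ℓ`, n1011-p01 `not_dvd_and_not_isSquare_discr_of_inert`; exactly
one of `c_v(W)`, `c_v(W^{(d_K)})` is `3`). Milne 1972 §1 / Kramer 1981 §2 shape; the `p = 3`
companion of C-3b's place list at the additive potentially-good places of type `IV`.
[cite: SilvermanATAEC1994, IV.9.4 Step 5 (PDF p. 344)] [cite: SilvermanAEC2009, Prop. VII.5.4 (a)] -/
theorem sum_fibre_padicValNat_localTamagawaNumber_of_kodairaSymbolAt_eq_IV_of_inert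
    (h2 : Module.finrank ℚ K = 2)
    {Cd : VariableChange ℚ} (hWd : Cd • W.quadraticTwist (NumberField.discr K : ℚ) = Wd)
    (hv2 : (primesEquiv v : ℕ) ≠ 2) (hv3 : (primesEquiv v : ℕ) ≠ 3) (hIV : W.kodairaSymbolAt v = .IV)
    {w : HeightOneSpectrum (𝓞 K)}
    (hset : {w' : HeightOneSpectrum (𝓞 K) | w'.under (𝓞 ℚ) = v} = {w})
    (he : w.asIdeal.ramificationIdx (𝓞 ℚ) = 1) (hf : w.asIdeal.inertiaDeg (𝓞 ℚ) = 2) :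
    ∑ w ∈ (HeightOneSpectrum.finite_setOf_under_eq_of_numberField (K := K) v).toFinset,
        padicValNat 3 (((W.baseChange K).baseChange (w.adicCompletion K)).localTamagawaNumber
          (w.adicCompletionIntegers K)) =
      padicValNat 3 ((W.baseChange (v.adicCompletion ℚ)).localTamagawaNumber
          (v.adicCompletionIntegers ℚ)) +
        padicValNat 3 ((Wd.baseChange (v.adicCompletion ℚ)).localTamagawaNumber
          (v.adicCompletionIntegers ℚ)) := by
  have hfin := HeightOneSpectrum.finite_setOf_under_eq_of_numberField (K := K) v
  have hw : w.under (𝓞 ℚ) = v := by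
    have h : w ∈ ({w} : Set (HeightOneSpectrum (𝓞 K))) := Set.mem_singleton _
    rwa [← hset] at h
  have hF : hfin.toFinset = {w} := by
    ext w'
    rw [Set.Finite.mem_toFinset, hset]
    simp
  obtain ⟨hnd, hnsq⟩ := not_dvd_and_not_isSquare_discr_of_inert v h2 hv2 hset he
  have hd : (NumberField.discr K : ℚ) ≠ 0 := by exact_mod_cast NumberField.discr_ne_zero K
  haveI := W.isElliptic_quadraticTwist hd
  have key := padicValNat_localTamagawaNumber_add_quadraticTwist_eq_one_of_kodairaSymbolAt_eq_IV W v
    hv2 hnd hnsq hIV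
  rw [hF, Finset.sum_singleton,
    localTamagawaNumber_baseChange_eq_three_of_kodairaSymbolAt_eq_IV_of_unramified_of_even v W hv3 hIV
      hw he (by rw [hf]; exact even_two),
    localTamagawaNumber_eq_of_variableChange_eq hWd v, key]
  simp

/-- **(T) at an INERT place of Kodaira type `IV*`, `p = 3`, `ℓ ≠ 2, 3`** — the Step-8 twin.
[cite: SilvermanATAEC1994, IV.9.4 Step 8 (PDF p. 346)] [cite: SilvermanAEC2009, Prop. VII.5.4 (a)] -/
theorem sum_fibre_padicValNat_localTamagawaNumber_of_kodairaSymbolAt_eq_IVstar_of_inert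
    (h2 : Module.finrank ℚ K = 2)
    {Cd : VariableChange ℚ} (hWd : Cd • W.quadraticTwist (NumberField.discr K : ℚ) = Wd)
    (hv2 : (primesEquiv v : ℕ) ≠ 2) (hv3 : (primesEquiv v : ℕ) ≠ 3)
    (hIV : W.kodairaSymbolAt v = .IVstar) {w : HeightOneSpectrum (𝓞 K)}
    (hset : {w' : HeightOneSpectrum (𝓞 K) | w'.under (𝓞 ℚ) = v} = {w})
    (he : w.asIdeal.ramificationIdx (𝓞 ℚ) = 1) (hf : w.asIdeal.inertiaDeg (𝓞 ℚ) = 2) :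
    ∑ w ∈ (HeightOneSpectrum.finite_setOf_under_eq_of_numberField (K := K) v).toFinset,
        padicValNat 3 (((W.baseChange K).baseChange (w.adicCompletion K)).localTamagawaNumber
          (w.adicCompletionIntegers K)) =
      padicValNat 3 ((W.baseChange (v.adicCompletion ℚ)).localTamagawaNumber
          (v.adicCompletionIntegers ℚ)) +
        padicValNat 3 ((Wd.baseChange (v.adicCompletion ℚ)).localTamagawaNumber
          (v.adicCompletionIntegers ℚ)) := by
  have hfin := HeightOneSpectrum.finite_setOf_under_eq_of_numberField (K := K) v
  have hw : w.under (𝓞 ℚ) = v := by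
    have h : w ∈ ({w} : Set (HeightOneSpectrum (𝓞 K))) := Set.mem_singleton _
    rwa [← hset] at h
  have hF : hfin.toFinset = {w} := by
    ext w'
    rw [Set.Finite.mem_toFinset, hset]
    simp
  obtain ⟨hnd, hnsq⟩ := not_dvd_and_not_isSquare_discr_of_inert v h2 hv2 hset he
  have hd : (NumberField.discr K : ℚ) ≠ 0 := by exact_mod_cast NumberField.discr_ne_zero K
  haveI := W.isElliptic_quadraticTwist hd
  have key := padicValNat_localTamagawaNumber_add_quadraticTwist_eq_one_of_kodairaSymbolAt_eq_IVstar W v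
    hv2 hnd hnsq hIV
  rw [hF, Finset.sum_singleton,
    localTamagawaNumber_baseChange_eq_three_of_kodairaSymbolAt_eq_IVstar_of_unramified_of_even v W hv3
      hIV hw he (by rw [hf]; exact even_two),
    localTamagawaNumber_eq_of_variableChange_eq hWd v, key]
  simp

end Fibre

end Summit.BirchSwinnertonDyer.Rank1Residual.AdditivePotMult

end
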